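import Summits.HodgeConjecture.HodgeConjecture.Theorems.F0P3cStCharTSJacCartanTube         -- ★-cand (C8b-tube): tube over a coset window, parametrisation, nested-or-disjoint windows (brings ★ C8b-window etc.)
import Literature.MeasureTheory.Measure.TubeIdentityPiSystemReduction                       -- ★ (Q4) F0P3a-p06: `measure_image_prod_eq_mul_lintegral_of_piSystem`, `measurableSet_generateFrom_of_isOpen_of_basis`, `measurableEmbedding_restrict_of_continuousOn_injOn`, `isPiSystem_of_subset_or_disjoint`
import Literature.MeasureTheory.Group.ConjugationFamilyFibres                               -- ★ `continuous_conjFamily_and_smul`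
import Literature.Topology.Metrizable.LocallyCompactPolish                                  -- ★ `polishSpace_of_locallyCompactSpace_of_secondCountableTopology`
import HarnessLib

/-!
# F0 · P3c · line LH6 «StCharTS» — WIF antecedent, ELLIPTIC half: brick (C8b-socket) «THE LOCAL TUBE-JACOBIAN SOCKET FROM CHART DATA»

Cell `pub/hodgecm-mathlib`, crux H413 = `stmt-HodgeConjecture-24833` (lane `--supports … --as helper`); seat LH5-p02 (g6); ROAD «JAC-ELL» v1 §2 steps (3)–(8),
in ★ (C4)'s ABSTRACT frame + complementary projections `pM + pT = id` + a closed subgroup `T ≤ G` linked to `ker pM` through the chart + an element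
`t₀ ∈ T` with `ρ t₀`, `ρ t₀⁻¹` integral + the linear part `L` and tube map `Θ` of ★ (C8b-core).  THEOREMS ONLY; Mathlib + ★ (C1)–(C5), (C8a),
(C8b-core∕product∕window) + ★ (Q1), (Q4) + ★ `ConjugationFamilyFibres`.

* §3 `tube_coset_identity` — `ν(Φ(A₀ × C)) = μ₀(A₀) · ∫⁻_C D dtm` on every coset window `C`, for `D` constant `= addEquivAddHaarChar L` on the base window
  (★ C8b-core tube measure + ★ C8b-window masses; the constant `κ` cancels — no index counting).
* §4 **`tubeJacobianLocal_of_chartData`** — THE SOCKET: with `U = {t ∈ T | t ∈ t₀·c(Λ_k)}` and `A₀ = π(c(Λ′_k))`,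
  `∀ V ⊆ U` Borel, `ν(Φ(A₀ × V)) = μ₀(A₀) · ∫⁻_V D dtm` (★ Q4 over the nested-or-disjoint coset windows; chart injectivity gives the measurable embedding).

Purpose: the abstract form of (E1b)'s hypothesis `hJacLoc` (★ `F0P3cStCharTSWeylCartanJacobian.lintegral_cartanSet_eq_of_tubeJacobian_local`); the model
`U(σ,J)(K) ⊃ Z(γ₀)` instantiates it in ★-cand `F0P3cStCharTSJacCartanElliptic` and ★ (Q9-CM) (A-p12) transports it to `Gqs L v`.
HONEST LABEL: count-neutral; closes no organ; HC_CM is proved only modulo the printed citations (h413 = `stmt-HodgeConjecture-24833`) until rung 0 closes.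

## References
* [HarishChandra1970] Harish-Chandra (notes by G. van Dijk), *Harmonic Analysis on Reductive p-adic Groups*, LNM 162 (1970), Lemma 22. Context locator.
* [Serre1992LALG] J.-P. Serre, *Lie Algebras and Lie Groups*, LNM 1500 (1992), Part II Ch. IV §8–§9. Context locator.
* [DeitmarEchterhoff2014] A. Deitmar, S. Echterhoff, *Principles of Harmonic Analysis*, 2nd ed., Thm. 1.5.3. Context locator.
* [Rogawski1990] J. D. Rogawski, *Automorphic Representations of Unitary Groups in Three Variables* (1990), §12.5 p. 182 (Weyl integration formula). Context locator.
-/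

set_option autoImplicit false
set_option linter.dupNamespace false

open Set Filter MeasureTheory MeasureTheory.Measure TopologicalSpace Topology Matrix ValuativeRel
open Literature.NumberTheory.Automorphic Literature.NumberTheory.Weil1982.UnitaryFinTopForm Literature.MeasureTheory.Group Literature.MeasureTheory.Measure
open Summit.HodgeConjecture.HodgeConjecture.Cruxes.H413.F0P3cStCharTSCayleyChartHaar
open Summit.HodgeConjecture.HodgeConjecture.Cruxes.H413.F0P3cStCharTSFilteredNewton
open Summit.HodgeConjecture.HodgeConjecture.Cruxes.H413.F0P3cStCharTSFilteredNewtonHaar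
open Summit.HodgeConjecture.HodgeConjecture.Cruxes.H413.F0P3cStCharTSNewtonChartHaar
open Summit.HodgeConjecture.HodgeConjecture.Cruxes.H413.F0P3cStCharTSTwistedTubeCore
open Summit.HodgeConjecture.HodgeConjecture.Cruxes.H413.F0P3cStCharTSJacCartanProduct
open Summit.HodgeConjecture.HodgeConjecture.Cruxes.H413.F0P3cStCharTSJacCartanWindow
open Summit.HodgeConjecture.HodgeConjecture.Cruxes.H413.F0P3cStCharTSJacCartanTube
open scoped Pointwise Topology ENNReal NNReal MatrixGroups

namespace Summit.HodgeConjecture.HodgeConjecture.Cruxes.H413.F0P3cStCharTSJacCartanSocketCore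

variable {K : Type*} [Field K] [ValuativeRel K] [TopologicalSpace K] [IsNonarchimedeanLocalField K]
  {m : Type*} [Fintype m] [DecidableEq m]
  {V : Type*} [AddCommGroup V] [TopologicalSpace V] [IsTopologicalAddGroup V] [T2Space V]
  {G : Type*} [Group G] [TopologicalSpace G] [IsTopologicalGroup G]
  (ι : V →+ Matrix m m K) (Λ : ℕ → AddSubgroup V) {α : ValueGroupWithZero K} (ρ : G →* GL m K) (c : V → G) (σV : V → V → V)
  (pM pT : V →+ V) {Λ' : ℕ → AddSubgroup V} (L : V ≃ₜ+ V) (Θ Ξ : V → V) (T : Subgroup G) {t₀ : G} {k : ℕ}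

section Measure

variable [SecondCountableTopology V] [LocallyCompactSpace V] [MeasurableSpace V] [BorelSpace V] (μ : Measure V) [μ.IsAddHaarMeasure]
  [T2Space G] [LocallyCompactSpace G] [SecondCountableTopology G] [MeasurableSpace G] [BorelSpace G]
  [MeasurableSpace (G ⧸ T)] [BorelSpace (G ⧸ T)]
  (ν : Measure G) [ν.IsHaarMeasure] [ν.IsMulRightInvariant]
  (tm : Measure ↥T) [tm.IsMulLeftInvariant] [IsFiniteMeasureOnCompacts tm] [tm.IsOpenPosMeasure] [tm.IsInvInvariant] [SFinite tm]

/-! ## §3 The identity on a coset window -/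

/-- **THE TUBE IDENTITY ON A COSET WINDOW**: `ν(Φ(A₀ × C)) = μ₀(A₀) · ∫⁻_C D dtm` for `A₀ = π c(Λ′_k)`, `C = {t | t ∈ t₀ c(Y + Λ_j)}`, with the weight `D`
constant `= addEquivAddHaarChar L` on the base window (★ C8b-core tube measure, ★ C8b-window masses; `κ` cancels). [cite: HarishChandra1970, Lemma 22]
[cite: Rogawski1990, §12.5 p. 182] -/
theorem tube_coset_identity (hTcl : IsClosed (T : Set G)) (hι : IsClosedEmbedding ι) (hΛ : ∀ j X, X ∈ Λ j ↔ ValBound (α ^ (j + 1)) (ι X)) (hα : α ≠ 0)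
    (hα1 : α < 1) (h2 : (2 : K) ≠ 0) (hρinj : Function.Injective ρ) (hc : ∀ X ∈ Λ 0, ((ρ (c X) : GL m K) : Matrix m m K) = cayley (ι X))
    (hcc : ContinuousOn c (Λ 0 : Set V)) (hK0 : IsOpen (c '' (Λ 0 : Set V)))
    (hσ : ∀ W ∈ Λ 0, ∀ X ∈ Λ 0, ι (σV W X) = (1 - ι W)⁻¹ * (ι W + ι X) * (1 + ι W * ι X)⁻¹ * (1 - ι W))
    (hσc : ∀ W ∈ Λ 0, ContinuousOn (σV W) (Λ 0 : Set V))
    (hΛ' : ∀ j Z, Z ∈ Λ' j ↔ (pM Z ∈ Λ j ∧ pT Z ∈ Λ j)) (hsum : ∀ Z, pM Z + pT Z = Z) (hidem : ∀ Z, pM (pM Z) = pM Z)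
    (hpMc : Continuous pM) (hpTc : Continuous pT) (hshift : ∀ j, ∀ Z ∈ Λ (j + k), pM Z ∈ Λ j ∧ pT Z ∈ Λ j)
    (hΞ : ∀ Z ∈ Λ' k, ι (Ξ Z) = (1 - ι (pM Z))⁻¹ * (ι (pM Z) + ι (pT Z)) * (1 + ι (pM Z) * ι (pT Z))⁻¹ * (1 - ι (pM Z)))
    (hcT : ∀ Y ∈ Λ 0, pM Y = 0 → c Y ∈ T) (hTc : ∀ W ∈ Λ 0, c W ∈ T → pM W = 0) (ht₀ : t₀ ∈ T)
    (hT1 : ValBound 1 ((ρ t₀ : GL m K) : Matrix m m K)) (hTinv1 : ValBound 1 (((ρ t₀)⁻¹ : GL m K) : Matrix m m K))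
    (hL : ∀ Z, ι (L Z) = (((ρ t₀)⁻¹ : GL m K) : Matrix m m K) * ι (pM Z) * ((ρ t₀ : GL m K) : Matrix m m K) - ι (pM Z) + ι (pT Z))
    (hΘ : ∀ Z ∈ Λ' k, ι (Θ Z) =
      (fun W X : Matrix m m K => (1 - W)⁻¹ * (W + X) * (1 + W * X)⁻¹ * (1 - W)) ((((ρ t₀)⁻¹ : GL m K) : Matrix m m K) * ι (pM Z) * ((ρ t₀ : GL m K) : Matrix m m K))
        ((fun W X : Matrix m m K => (1 - W)⁻¹ * (W + X) * (1 + W * X)⁻¹ * (1 - W)) (ι (pT Z)) (-ι (pM Z))))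
    (hshiftL : ∀ j, ∀ Z ∈ Λ (j + k), pM (L.symm Z) ∈ Λ j ∧ pT (L.symm Z) ∈ Λ j)
    {κ : ℝ≥0∞} (hκ0 : κ ≠ 0) (hκt : κ ≠ ∞) (hchart : ∀ B ⊆ (Λ 0 : Set V), MeasurableSet (c '' B) → κ * ν (c '' B) = μ B)
    (Φ : (G ⧸ T) × ↥T → G) (hΦ : ∀ (x : G) (t : ↥T), Φ (QuotientGroup.mk x, t) = x * t * x⁻¹)
    (D : ↥T → ℝ≥0) (hD : ∀ t : ↥T, (t : G) ∈ t₀ • c '' (Λ k : Set V) → D t = D ⟨t₀, ht₀⟩) (hDχ : ((D ⟨t₀, ht₀⟩ : ℝ≥0) : ℝ≥0∞) = addEquivAddHaarChar L)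
    {j : ℕ} (hj : k ≤ j) {Y : V} (hY : Y ∈ Λ k) (hY0 : pM Y = 0) :
    ν (Φ '' (((QuotientGroup.mk : G → G ⧸ T) '' (c '' (Λ' k : Set V))) ×ˢ {t : ↥T | (t : G) ∈ t₀ • c '' (Y +ᵥ (Λ j : Set V))})) =
      quotientMeasure T tm hTcl ν ((QuotientGroup.mk : G → G ⧸ T) '' (c '' (Λ' k : Set V))) *
        ∫⁻ t in {t : ↥T | (t : G) ∈ t₀ • c '' (Y +ᵥ (Λ j : Set V))}, (D t : ℝ≥0∞) ∂tm := by
  have hanti := level_antitone ι Λ hΛ hα1.le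
  have hk0 : Λ k ≤ Λ 0 := hanti (Nat.zero_le k)
  have hjk : Λ j ≤ Λ k := hanti hj
  have hP := proj_ids pM pT hsum hidem
  have hcinj := injOn_chart ι Λ ρ c h2 hι.injective hΛ hα1 hc
  have hcomp0 : IsCompact (Λ 0 : Set V) := isCompact_level ι Λ hι hΛ 0
  have hYcos : Y +ᵥ (Λ j : Set V) ⊆ (Λ k : Set V) := by rintro _ ⟨y, hy, rfl⟩; exact add_mem hY (hjk hy)
  -- (1) the tube is `t₀ · c(Θ A)`
  rw [tube_image_eq ι Λ ρ c pM pT Θ Ξ T hι hΛ hα hα1 hρinj hc hΛ' hsum hidem hpMc hpTc hshift hΞ hcT hTc ht₀ hT1 hTinv1 hΘ Φ hΦ hj hY]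
  set A : Set V := (Λ' k : Set V) ∩ pT ⁻¹' (Y +ᵥ (Λ j : Set V)) with hAdef
  set A0 : Set V := (Λ' k : Set V) ∩ pT ⁻¹' (Λ j : Set V) with hA0def
  set C : Set ↥T := {t : ↥T | (t : G) ∈ t₀ • c '' (Y +ᵥ (Λ j : Set V))} with hCdef
  set T₀ : Set ↥T := {h : ↥T | (h : G) ∈ c '' (Λ j : Set V)} with hT₀def
  -- (2) ★ C8b-core: `κ · ν(t₀ c(Θ A)) = χ · μ A`
  have hΘA : IsOpen (Θ '' A) := isOpen_image_twisted ι Λ pM pT L Θ hι hΛ hα hα1 hΛ' hsum hpMc hpTc hshift hT1 hTinv1 hL hΘ hshiftL hj Y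
  have hΘA0 : Θ '' A ⊆ (Λ 0 : Set V) := by
    rintro _ ⟨Z, hZ, rfl⟩; exact hk0 (twisted_mem_level ι Λ pM pT Θ hΛ hα1 hΛ' hT1 hTinv1 hΘ Z hZ.1)
  have hC8 := tube_measure_eq_twisted ι Λ c pM pT L Θ μ ν hι hΛ hα hα1 hΛ' hsum hshift hT1 hTinv1 hL hΘ
    (continuousOn_twisted ι Λ pM pT hι hΛ hα1 hΛ' hpMc hpTc hT1 hTinv1 Θ hΘ) hshiftL hchart t₀ (inter_subset_left : A ⊆ (Λ' k : Set V))
    hΘA.measurableSet (isOpen_image_of_subset c hcc hcinj hcomp0 hK0 hΘA hΘA0).measurableSet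
  -- (3) `μ A = μ A0` (translation by `Y ∈ 𝔱 ∩ Λ_k`)
  have hYk' : Y ∈ Λ' k := (hΛ' k Y).2 ⟨by rw [hY0]; exact zero_mem _, by rw [(hP Y).2.2.2.2 hY0]; exact hY⟩
  have hAeq : A = Y +ᵥ A0 := by
    ext Z
    rw [Set.mem_vadd_set_iff_neg_vadd_mem]
    simp only [hAdef, hA0def, mem_inter_iff, mem_preimage, SetLike.mem_coe, vadd_eq_add]
    rw [Set.mem_vadd_set_iff_neg_vadd_mem, vadd_eq_add, map_add, map_neg, (hP Y).2.2.2.2 hY0]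
    constructor
    · rintro ⟨h1, h2⟩; exact ⟨add_mem (neg_mem hYk') h1, h2⟩
    · rintro ⟨h1, h2⟩; exact ⟨by simpa using add_mem hYk' h1, h2⟩
  have hμA : μ A = μ A0 := by rw [hAeq, measure_vadd]
  -- (4) ★ C8b-window
  have hW1 := chart_window_eq ι Λ ρ c pM pT Ξ ν μ hι hΛ hα hα1 h2 hc hcc hK0 hΛ' hsum hpMc hpTc hshift hΞ hchart hj
  have hW2 := measure_window_eq ι Λ ρ c σV pM pT Ξ T ν tm hTcl hι hΛ hα hα1 h2 hρinj hc hcc hK0 hσ hσc hΛ' hsum hidem hpMc hpTc hshift hΞ hcT hTc hj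
  -- (5) `tm C = tm T₀` (left translation by `t₀ c Y ∈ T`)
  have hgT : t₀ * c Y ∈ T := T.mul_mem ht₀ (hcT Y (hk0 hY) hY0)
  have hCeq : C = (fun t : ↥T => (⟨t₀ * c Y, hgT⟩ : ↥T)⁻¹ * t) ⁻¹' T₀ := by
    ext t
    simp only [hCdef, hT₀def, mem_setOf_eq, mem_preimage]
    rw [image_vadd_eq_smul_image ι Λ ρ c σV hι hΛ hα hα1 h2 hρinj hc hσ hσc hj hY, smul_smul, Set.mem_smul_set_iff_inv_smul_mem, smul_eq_mul]
    rfl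
  have htmC : tm C = tm T₀ := by rw [hCeq, measure_preimage_mul]
  -- (6) the weight is constant on `C ⊆ U`
  have hCU : ∀ t ∈ C, (t : G) ∈ t₀ • c '' (Λ k : Set V) := fun t ht => smul_set_mono (image_mono hYcos) ht
  have hCo : IsOpen C := ((isOpen_image_of_subset c hcc hcinj hcomp0 hK0 ((isOpen_level ι Λ hι.continuous hΛ hα j).vadd Y)
    (hYcos.trans hk0)).smul t₀).preimage continuous_subtype_val
  have hint : ∫⁻ t in C, (D t : ℝ≥0∞) ∂tm = (D ⟨t₀, ht₀⟩ : ℝ≥0∞) * tm C := by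
    rw [setLIntegral_congr_fun hCo.measurableSet (fun t ht => by rw [hD t (hCU t ht)]), setLIntegral_const]
  -- (7) bookkeeping: `κ x = χ μA0 = χ κ ν K′` ⇒ `x = χ ν K′ = χ μ₀(A₀) tm T₀`
  rw [hint, htmC, hDχ]
  rw [hμA, ← hW1] at hC8
  have hx : ν (t₀ • c '' (Θ '' A)) = addEquivAddHaarChar L * ν (c '' (Ξ '' A0)) := by
    rw [← ENNReal.mul_right_inj hκ0 hκt, hC8]; ring
  rw [hx, hW2]; ring

/-! ## §4 The socket -/

/-- **THE LOCAL TUBE-JACOBIAN SOCKET FROM CHART DATA.**  In ★ (C4)'s frame with complementary continuous additive projections `pM + pT = id` (`pM`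
idempotent), a closed subgroup `T` linked to `ker pM` through the chart, `t₀ ∈ T` with `ρ t₀^{±1}` integral, the linear part `L` and tube map `Θ` of ★ (C8b-core),
and a weight `D` constant `= addEquivAddHaarChar L` on the base window: with `U = {t ∈ T | t ∈ t₀ c(Λ_k)}` and `A₀ = π(c(Λ′_k))` (of positive finite quotient
mass), **`ν(Φ(A₀ × V)) = μ₀(A₀) · ∫⁻_V D dtm` for every Borel `V ⊆ U`** — ★ (Q4) over the nested-or-disjoint coset windows, the identity on each window being
`tube_coset_identity`, the measurable embedding coming from chart injectivity. [cite: HarishChandra1970, Lemma 22] [cite: Rogawski1990, §12.5 p. 182] -/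
theorem tubeJacobianLocal_of_chartData (hTcl : IsClosed (T : Set G)) (hι : IsClosedEmbedding ι) (hΛ : ∀ j X, X ∈ Λ j ↔ ValBound (α ^ (j + 1)) (ι X))
    (hα : α ≠ 0) (hα1 : α < 1) (h2 : (2 : K) ≠ 0) (hρinj : Function.Injective ρ) (hc : ∀ X ∈ Λ 0, ((ρ (c X) : GL m K) : Matrix m m K) = cayley (ι X))
    (hcc : ContinuousOn c (Λ 0 : Set V)) (hK0 : IsOpen (c '' (Λ 0 : Set V)))
    (hσ : ∀ W ∈ Λ 0, ∀ X ∈ Λ 0, ι (σV W X) = (1 - ι W)⁻¹ * (ι W + ι X) * (1 + ι W * ι X)⁻¹ * (1 - ι W))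
    (hσc : ∀ W ∈ Λ 0, ContinuousOn (σV W) (Λ 0 : Set V))
    (hΛ' : ∀ j Z, Z ∈ Λ' j ↔ (pM Z ∈ Λ j ∧ pT Z ∈ Λ j)) (hsum : ∀ Z, pM Z + pT Z = Z) (hidem : ∀ Z, pM (pM Z) = pM Z)
    (hpMc : Continuous pM) (hpTc : Continuous pT) (hshift : ∀ j, ∀ Z ∈ Λ (j + k), pM Z ∈ Λ j ∧ pT Z ∈ Λ j)
    (hΞ : ∀ Z ∈ Λ' k, ι (Ξ Z) = (1 - ι (pM Z))⁻¹ * (ι (pM Z) + ι (pT Z)) * (1 + ι (pM Z) * ι (pT Z))⁻¹ * (1 - ι (pM Z)))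
    (hcT : ∀ Y ∈ Λ 0, pM Y = 0 → c Y ∈ T) (hTc : ∀ W ∈ Λ 0, c W ∈ T → pM W = 0) (ht₀ : t₀ ∈ T)
    (hT1 : ValBound 1 ((ρ t₀ : GL m K) : Matrix m m K)) (hTinv1 : ValBound 1 (((ρ t₀)⁻¹ : GL m K) : Matrix m m K))
    (hL : ∀ Z, ι (L Z) = (((ρ t₀)⁻¹ : GL m K) : Matrix m m K) * ι (pM Z) * ((ρ t₀ : GL m K) : Matrix m m K) - ι (pM Z) + ι (pT Z))
    (hΘ : ∀ Z ∈ Λ' k, ι (Θ Z) =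
      (fun W X : Matrix m m K => (1 - W)⁻¹ * (W + X) * (1 + W * X)⁻¹ * (1 - W)) ((((ρ t₀)⁻¹ : GL m K) : Matrix m m K) * ι (pM Z) * ((ρ t₀ : GL m K) : Matrix m m K))
        ((fun W X : Matrix m m K => (1 - W)⁻¹ * (W + X) * (1 + W * X)⁻¹ * (1 - W)) (ι (pT Z)) (-ι (pM Z))))
    (hshiftL : ∀ j, ∀ Z ∈ Λ (j + k), pM (L.symm Z) ∈ Λ j ∧ pT (L.symm Z) ∈ Λ j)
    {κ : ℝ≥0∞} (hκ0 : κ ≠ 0) (hκt : κ ≠ ∞) (hchart : ∀ B ⊆ (Λ 0 : Set V), MeasurableSet (c '' B) → κ * ν (c '' B) = μ B)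
    (Φ : (G ⧸ T) × ↥T → G) (hΦ : ∀ (x : G) (t : ↥T), Φ (QuotientGroup.mk x, t) = x * t * x⁻¹)
    (D : ↥T → ℝ≥0) (hD : ∀ t : ↥T, (t : G) ∈ t₀ • c '' (Λ k : Set V) → D t = D ⟨t₀, ht₀⟩) (hDχ : ((D ⟨t₀, ht₀⟩ : ℝ≥0) : ℝ≥0∞) = addEquivAddHaarChar L) :
    ∃ U : Set ↥T, IsOpen U ∧ (⟨t₀, ht₀⟩ : ↥T) ∈ U ∧
      ∃ A₀ : Set (G ⧸ T), MeasurableSet A₀ ∧ quotientMeasure T tm hTcl ν A₀ ≠ 0 ∧ quotientMeasure T tm hTcl ν A₀ ≠ ∞ ∧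
        ∀ V' : Set ↥T, MeasurableSet V' → V' ⊆ U →
          ν (Φ '' (A₀ ×ˢ V')) = quotientMeasure T tm hTcl ν A₀ * ∫⁻ t in V', (D t : ℝ≥0∞) ∂tm := by
  haveI : IsClosed (T : Set G) := hTcl
  have hanti := level_antitone ι Λ hΛ hα1.le
  have hanti' : Antitone Λ' := subBox_antitone hΛ' hanti
  have hk0 : Λ k ≤ Λ 0 := hanti (Nat.zero_le k)
  have hP := proj_ids pM pT hsum hidem
  have hcinj := injOn_chart ι Λ ρ c h2 hι.injective hΛ hα1 hc
  have hcomp0 : IsCompact (Λ 0 : Set V) := isCompact_level ι Λ hι hΛ 0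
  have hopenΛ := isOpen_level ι Λ hι.continuous hΛ hα
  have h0 : c 0 = 1 := chart_zero ι Λ ρ c hρinj hc
  -- the window `U` and the transversal `A₀`
  set U : Set ↥T := {t : ↥T | (t : G) ∈ t₀ • c '' (Λ k : Set V)} with hUdef
  set A₀ : Set (G ⧸ T) := (QuotientGroup.mk : G → G ⧸ T) '' (c '' (Λ' k : Set V)) with hA₀def
  have hopen_img : ∀ {S : Set V}, IsOpen S → S ⊆ (Λ 0 : Set V) → IsOpen {t : ↥T | (t : G) ∈ t₀ • c '' S} := fun hS hS0 =>
    ((isOpen_image_of_subset c hcc hcinj hcomp0 hK0 hS hS0).smul t₀).preimage continuous_subtype_val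
  have hUo : IsOpen U := hopen_img (hopenΛ k) hk0
  have ht₀U : (⟨t₀, ht₀⟩ : ↥T) ∈ U := ⟨1, ⟨0, zero_mem _, h0⟩, by simp⟩
  have hA₀m : MeasurableSet A₀ :=
    measurableSet_image_mk_of_isOpen' T (isOpen_image_of_subset c hcc hcinj hcomp0 hK0 (isOpen_subBox hΛ' hopenΛ hshift k) ((subBox_le hΛ' hsum k).trans hk0))
  have hne := quotientMeasure_window_ne ι Λ ρ c σV pM pT Ξ T ν tm hTcl hι hΛ hα hα1 h2 hρinj hc hcc hK0 hσ hσc hΛ' hsum hidem hpMc hpTc hshift hΞ hcT hTc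
  refine ⟨U, hUo, ht₀U, A₀, hA₀m, hne.1, hne.2, fun V' hV' hV'U => ?_⟩
  -- the coset windows
  set 𝒞 : Set (Set ↥T) := {C | ∃ j, k ≤ j ∧ ∃ Y ∈ (Λ k : Set V), pM Y = 0 ∧ C = {t : ↥T | (t : G) ∈ t₀ • c '' (Y +ᵥ (Λ j : Set V))}} with h𝒞def
  have hYcos : ∀ {j : ℕ} {Y : V}, k ≤ j → Y ∈ Λ k → Y +ᵥ (Λ j : Set V) ⊆ (Λ k : Set V) := by
    rintro j Y hj hY _ ⟨y, hy, rfl⟩; exact add_mem hY (hanti hj hy)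
  have hUeq : U = {t : ↥T | (t : G) ∈ t₀ • c '' ((0 : V) +ᵥ (Λ k : Set V))} := by rw [zero_vadd]
  have hU𝒞 : U ∈ 𝒞 := ⟨k, le_rfl, 0, zero_mem _, map_zero _, hUeq⟩
  have h𝒞o : ∀ C ∈ 𝒞, IsOpen C := by
    rintro C ⟨j, hj, Y, hY, -, rfl⟩; exact hopen_img ((hopenΛ j).vadd Y) ((hYcos hj hY).trans hk0)
  have h𝒞U : ∀ C ∈ 𝒞, C ⊆ U := by
    rintro C ⟨j, hj, Y, hY, -, rfl⟩ t ht; exact smul_set_mono (image_mono (hYcos hj hY)) ht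
  have hπ : IsPiSystem 𝒞 := isPiSystem_of_subset_or_disjoint 𝒞 (by
    rintro C ⟨j, hj, Y, hY, -, rfl⟩ C' ⟨j', hj', Y', hY', -, rfl⟩
    exact cosetWindow_nested_or_disjoint ι Λ ρ c T hι.injective hΛ hα1 h2 hc hj hj' hY hY')
  have hbasis : ∀ O : Set ↥T, IsOpen O → O ⊆ U → ∀ y ∈ O, ∃ C ∈ 𝒞, y ∈ C ∧ C ⊆ O := by
    intro O hO hOU y hy
    obtain ⟨_, ⟨Y, hY, rfl⟩, hyY⟩ := hOU hy
    have hyY' : t₀ * c Y = (y : G) := hyY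
    have hcYT : c Y ∈ T := by
      have : c Y = t₀⁻¹ * (y : G) := by rw [← hyY', inv_mul_cancel_left]
      rw [this]; exact T.mul_mem (T.inv_mem ht₀) y.2
    have hY0 : pM Y = 0 := hTc Y (hk0 hY) hcYT
    obtain ⟨O', hO', rfl⟩ := isOpen_induced_iff.1 hO
    have hO'y : {g : G | (y : G) * g ∈ O'} ∈ 𝓝 (1 : G) :=
      (hO'.preimage (continuous_const.mul continuous_id)).mem_nhds (by simpa using hy)
    obtain ⟨j', hj'⟩ := exists_image_level_subset Λ c hopenΛ (exists_level_subset_of_mem_nhds ι Λ hι hΛ hα1) hcc h0 _ hO'y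
    refine ⟨{t : ↥T | (t : G) ∈ t₀ • c '' (Y +ᵥ (Λ (max j' k) : Set V))}, ⟨max j' k, le_max_right _ _, Y, hY, hY0, rfl⟩, ?_, ?_⟩
    · exact ⟨c Y, ⟨Y, ⟨0, zero_mem _, by simp⟩, rfl⟩, hyY'⟩
    · intro t ht
      rw [mem_setOf_eq, image_vadd_eq_smul_image ι Λ ρ c σV hι hΛ hα hα1 h2 hρinj hc hσ hσc (le_max_right j' k) hY, smul_smul, hyY'] at ht
      obtain ⟨_, ⟨z, hz, rfl⟩, htz⟩ := ht
      show (t : G) ∈ O'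
      rw [← htz]
      exact hj' ⟨z, hanti (le_max_left j' k) hz, rfl⟩
  have heq : ∀ C ∈ 𝒞, ν (Φ '' (A₀ ×ˢ C)) = quotientMeasure T tm hTcl ν A₀ * ∫⁻ t in C, (D t : ℝ≥0∞) ∂tm := by
    rintro C ⟨j, hj, Y, hY, hY0, rfl⟩
    exact tube_coset_identity ι Λ ρ c σV pM pT L Θ Ξ T μ ν tm hTcl hι hΛ hα hα1 h2 hρinj hc hcc hK0 hσ hσc hΛ' hsum hidem hpMc hpTc hshift hΞ hcT hTc ht₀
      hT1 hTinv1 hL hΘ hshiftL hκ0 hκt hchart Φ hΦ D hD hDχ hj hY hY0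
  -- finiteness of the tube over `U`
  have hfin : ν (Φ '' (A₀ ×ˢ U)) ≠ ∞ := by
    rw [hUeq, hA₀def, tube_image_eq ι Λ ρ c pM pT Θ Ξ T hι hΛ hα hα1 hρinj hc hΛ' hsum hidem hpMc hpTc hshift hΞ hcT hTc ht₀ hT1 hTinv1 hΘ Φ hΦ le_rfl
      (zero_mem _), measure_smul]
    refine ((measure_mono ?_).trans_lt ((hcomp0.image_of_continuousOn hcc).measure_lt_top (μ := ν))).ne
    rintro _ ⟨_, ⟨Z, hZ, rfl⟩, rfl⟩
    exact ⟨Θ Z, hk0 (twisted_mem_level ι Λ pM pT Θ hΛ hα1 hΛ' hT1 hTinv1 hΘ Z hZ.1), rfl⟩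
  -- the measurable embedding: continuity of `Φ` and chart injectivity on `A₀ × U`
  haveI : PolishSpace G := Literature.Topology.Metrizable.polishSpace_of_locallyCompactSpace_of_secondCountableTopology G
  haveI : PolishSpace (G ⧸ T) := Literature.Topology.Metrizable.polishSpace_of_locallyCompactSpace_of_secondCountableTopology _
  haveI : PolishSpace ↥T := hTcl.polishSpace
  have hΦc : Continuous Φ := (continuous_conjFamily_and_smul T Φ hΦ).1
  have hinjΘ : InjOn Θ (Λ' k : Set V) := injOn_of_linearNewton Λ' Θ L hanti' (subBox_basis hΛ' hsum (exists_level_subset_of_mem_nhds ι Λ hι hΛ hα1))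
    (twisted_newton ι Λ pM pT L Θ hΛ hα1 hΛ' hT1 hTinv1 hL hΘ hshiftL)
  have hinj : InjOn Φ (A₀ ×ˢ U) := by
    rintro ⟨q, t⟩ ⟨hq, ht⟩ ⟨q', t'⟩ ⟨hq', ht'⟩ hEq
    rw [hUdef, mem_setOf_eq, ← zero_vadd V (Λ k : Set V)] at ht ht'
    obtain ⟨Z, hZ, hqZ, htZ, hΦZ⟩ := exists_param ι Λ ρ c pM pT Θ Ξ T hι hΛ hα hα1 hρinj hc hΛ' hsum hidem hpMc hpTc hshift hΞ hcT hTc ht₀ hT1 hTinv1 hΘ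
      Φ hΦ le_rfl (zero_mem _) hq ht
    obtain ⟨Z', hZ', hqZ', htZ', hΦZ'⟩ := exists_param ι Λ ρ c pM pT Θ Ξ T hι hΛ hα hα1 hρinj hc hΛ' hsum hidem hpMc hpTc hshift hΞ hcT hTc ht₀ hT1 hTinv1 hΘ
      Φ hΦ le_rfl (zero_mem _) hq' ht'
    have hE : Φ (q, t) = Φ (q', t') := hEq
    rw [hΦZ, hΦZ'] at hE
    have hZZ : Z = Z' := hinjΘ hZ.1 hZ'.1 (hcinj (hk0 (twisted_mem_level ι Λ pM pT Θ hΛ hα1 hΛ' hT1 hTinv1 hΘ Z hZ.1))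
      (hk0 (twisted_mem_level ι Λ pM pT Θ hΛ hα1 hΛ' hT1 hTinv1 hΘ Z' hZ'.1)) (mul_left_cancel hE))
    subst hZZ
    exact Prod.ext (hqZ.trans hqZ'.symm) (Subtype.ext (htZ.trans htZ'.symm))
  have hΦe : MeasurableEmbedding ((A₀ ×ˢ U).restrict Φ) :=
    measurableEmbedding_restrict_of_continuousOn_injOn Φ hA₀m hUo.measurableSet hΦc.continuousOn hinj
  exact measure_image_prod_eq_mul_lintegral_of_piSystem Φ ν tm (quotientMeasure T tm hTcl ν A₀) hUo hΦe hfin 𝒞 hπ hU𝒞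
    (fun C hC => (h𝒞o C hC).measurableSet) h𝒞U (fun O hO hOU => measurableSet_generateFrom_of_isOpen_of_basis 𝒞 h𝒞o hbasis hO hOU) heq hV' hV'U

end Measure

end Summit.HodgeConjecture.HodgeConjecture.Cruxes.H413.F0P3cStCharTSJacCartanSocketCore
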